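import Literature.Probability.FitznerVanDerHofstad2017.NobleBoundsNClasses
import HarnessLib

/-!
# [FvdH17] §6.2.1 (6.48)–(6.51) for general `N`: the regrouping assembly with an ARBITRARY finite class index and an arbitrary finite cover

Source: R. Fitzner, R. van der Hofstad, *Mean-field behavior for nearest-neighbor percolation in `d > 10`*,
Electron. J. Probab. **22** (2017) no. 43 [FvdH17]; locators are those of arXiv:1506.07977v2: §6.1 (6.4) (p. 58),
§6.2.1 (6.48)–(6.50) (p. 65), Lemma 6.1 (6.51) (p. 66), and the closing paragraph of §6.2.1 (p. 67: "we identify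
this as a massive sum over classes (a_i) and over (κ_i) … (6.49) is obtained by performing the sums iteratively").

`NobleBoundsNClasses.nobleXiT_le_recP_chain_of_cls` performs the regrouping of a POINTWISE chain estimate into the
recursion `recP` of (6.49) for the class index `Fin 3` (line classes `0̲, 1̲, 2̲` read by `lineClass` on the levels,
`clsSetN`).  The abstract regrouping `BlockSummation.le_recP_chain_of_pointwise` is, however, generic in the class
type `ι`; this module records the corresponding percolation assembly for an ARBITRARY finite class index `ι` and an
ARBITRARY finite cover `C(b,w,t,z;a,c)` of the bounding events (`E ⊆ ⋃_{a,c} C a c`) — so that the owner of the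
`N ≥ 2` cover may REFINE the printed classes (e.g. by the type of the junction between consecutive levels, cf. the
typed `Ξ^{(N)}`'s adjoined vertex `A' = {u_{i-1}}` in `NobleNestedXi.nestXi`, which the printed (6.49) does not
see) without touching the algebra: every refinement is just a larger finite `ι` and its own block families
`S, B, A, P^E` over it, and the matrix consumers `BlockSummation.tsum_le_vecMul_pow_dotProduct(')`,
`BlockSummationAvg.…` are generic in `ι` as well.

Proved here (any `d`, any `p`; kernel-checked, no named fact):
* `measure_le_sum_sum_inter_of_subset` — `μ E ≤ Σ_{a,c} μ (E ∩ C a c)` for a finite double-indexed cover;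
* `le_recP_chain_of_cover` — the ABSTRACT assembly (any measure space, any weight `J`, any left-hand side `Ξ`):
  cover + class estimates ⇒ the `recP` chain bound; `sum_le_recP_chain_of_pointwise` — finitely many pointwise
  chains whose start piece depends on the first direction `κ_0` (the `ι`-start of (5.37)), summed into one chain
  with a `κ`-free start `S ≥ Σ_j T_j^{κ}`;
* `tsum_mul_tsum₃_eq` — reshaping `Σ_b J(b)·Σ_{w,t,z} F = Σ_{b,w,t,z} J(b)·F` (the output shape of a
  cover-based union bound into the input shape `h1` below);
* `nobleXiT_le_recP_chain_of_cover` — the assembly: from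
  `h1 : Ξ^{(n+1)}(x) ≤ Σ_{b,w,t,z} (∏_i J(v_i−u_i)) ℙ^{⊗(n+2)}(E(b,w,t,z))`, a finite cover `E ⊆ ⋃_{a,c} C(a,c)`
  (`a : Fin (n+1) → ι`, `c : ι`) and the class estimates
  `h2 : (∏J) ℙ^{⊗(n+2)}(E ∩ C(a,c)) ≤ Σ_κ 𝟙{v = u + e_κ} S^{a_0}(u_0,w_0) · chainTail`, conclude the `x`-space bound
  `Ξ^{(n+1)}(x) ≤ Σ_{u,w,t,z} Σ_{κ,a,c} P^{(n),a}(u,w) A^{κ,a,c}(u,w,t,z) P^{E,c}(t−x,z−x)`;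
* `nobleXiT_le_recP_chain_of_cover'` — the same with `h1` in the shape `Σ_b (∏J) Σ_{w,t,z} ℙ(E)`.
`nobleXiT_le_recP_chain_of_cls` (landed, `NobleBoundsNClasses`) is the instance `ι = Fin 3`,
`C(b,w,t,z;a,c) = clsSetN u w t_n z_n a c` (a partition, `iUnion_clsSetN`) and is not restated here.

ADDITIVE module: nothing in `NobleBoundsNClasses`, `BlockSummation` is modified.
-/

noncomputable section

open scoped BigOperators ENNReal

namespace Literature.Probability.FitznerVanDerHofstad2017

open _root_.MeasureTheory
open Literature.Probability.FitznerVanDerHofstad2017.NobleBlocks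
open Literature.Probability.FitznerVanDerHofstad2017.BlockSummation
open Literature.Probability.Percolation Literature.Probability.LatticeModels
open Literature.Barriers.CriticalPhenomena

/-! ## §1. Two bookkeeping lemmas -/

section Cover

variable {Ω : Type*} [MeasurableSpace Ω] {α γ : Type*} [Fintype α] [Fintype γ]

/-- **Finite double-indexed cover ⇒ union bound**: if `E ⊆ ⋃_{a,c} C a c` then `μ E ≤ Σ_a Σ_c μ (E ∩ C a c)`
(no measurability needed). [folklore] -/
theorem measure_le_sum_sum_inter_of_subset (μ : Measure Ω) (E : Set Ω) (C : α → γ → Set Ω)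
    (hC : E ⊆ ⋃ a, ⋃ c, C a c) : μ E ≤ ∑ a, ∑ c, μ (E ∩ C a c) := by
  have hE : E ⊆ ⋃ a, ⋃ c, E ∩ C a c := by
    intro ω hω
    obtain ⟨a, c, hac⟩ : ∃ a c, ω ∈ C a c := by simpa only [Set.mem_iUnion] using hC hω
    exact Set.mem_iUnion.2 ⟨a, Set.mem_iUnion.2 ⟨c, hω, hac⟩⟩
  calc μ E ≤ μ (⋃ a, ⋃ c, E ∩ C a c) := measure_mono hE
    _ ≤ ∑ a, μ (⋃ c, E ∩ C a c) := measure_iUnion_fintype_le μ _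
    _ ≤ ∑ a, ∑ c, μ (E ∩ C a c) := Finset.sum_le_sum fun a _ => measure_iUnion_fintype_le μ _

end Cover

variable {d : ℕ}

/-- Reshaping the output of a cover-based union bound, `Σ_b J(b) · Σ_{w,t,z} F(b,w,t,z)`, into the fourfold sum
`Σ_{b,w,t,z} J(b) · F` (used with `J = ∏_i J(v_i − u_i)`, `NobleNestedXi.bondJProd`). [folklore] -/
theorem tsum_mul_tsum₃_eq {β₀ β₁ β₂ β₃ : Type*} (J : β₀ → ℝ≥0∞) (F : β₀ → β₁ → β₂ → β₃ → ℝ≥0∞) :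
    ∑' b, J b * ∑' w, ∑' t, ∑' z, F b w t z = ∑' b, ∑' w, ∑' t, ∑' z, J b * F b w t z := by
  simp only [ENNReal.tsum_mul_left]

/-! ## §1b. The regrouping from a finite cover, abstract form (any measure space, any weight, any left-hand side) -/

section Abstract

variable {Ω : Type*} [MeasurableSpace Ω] {ι K : Type*} [Fintype ι] [Fintype K]

/-- **Cover ⇒ class split ⇒ `recP` chain, abstractly.**  For ANY quantity `Ξ ∈ [0,∞]`, any measure `μ` on any
space, any weight `J(b)` and events `E(b,w,t,z)` with `Ξ ≤ Σ_{b,w,t,z} J(b) μ(E(b,w,t,z))`, any finite cover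
`E ⊆ ⋃_{a,c} C(a,c)` and class estimates `J(b) μ(E ∩ C(a,c)) ≤ Σ_κ dirInd e κ b · (S^{a_0}(u_0,w_0) · chainTail)`
with `Σ_{t,z} B_pt ≤ B`: `Ξ ≤ Σ_{u,w,t,z} Σ_{κ,a,c} P^{(n),a}(u,w) A^{κ,a,c}(u,w,t,z) P^{E,c}(t−x,z−x)`.  This is
`BlockSummation.le_recP_chain_of_pointwise` composed with the union bound; it serves `Ξ^{(N)}`, `Ξ^{(N),ι}` (one
`ι` at a time or summed, see `sum_le_recP_chain_of_pointwise`) and any other left-hand side alike.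
[cite: FitznerVanDerHofstad2017, §6.1 (6.4) (p. 58), §6.2.1 (6.48)–(6.51) (pp. 65–67) (arXiv:1506.07977v2)] -/
theorem le_recP_chain_of_cover (μ : Measure Ω) (e : K → Site d)
    (B : K → ι → ι → Site d → Site d → Site d → Site d → ℝ≥0∞)
    (Bpt : K → ι → ι → Site d → Site d → Site d → Site d → Site d → Site d → ℝ≥0∞)
    (hBpt : ∀ κ a a' u w w' u', ∑' t, ∑' z, Bpt κ a a' u w t z w' u' ≤ B κ a a' u w w' u')
    (A : K → ι → ι → Site d → Site d → Site d → Site d → ℝ≥0∞) (PE : ι → Site d → Site d → ℝ≥0∞) (x : Site d)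
    (n : ℕ) (S : ι → Site d → Site d → ℝ≥0∞) (Ξ : ℝ≥0∞) (J : (Fin (n + 1) → Site d × Site d) → ℝ≥0∞)
    (E : (Fin (n + 1) → Site d × Site d) → (Fin (n + 1) → Site d) → (Fin (n + 1) → Site d) →
      (Fin (n + 1) → Site d) → Set Ω)
    (C : (Fin (n + 1) → Site d × Site d) → (Fin (n + 1) → Site d) → (Fin (n + 1) → Site d) →
      (Fin (n + 1) → Site d) → (Fin (n + 1) → ι) → ι → Set Ω)
    (hC : ∀ b w t z, E b w t z ⊆ ⋃ a, ⋃ c, C b w t z a c)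
    (h1 : Ξ ≤ ∑' b : Fin (n + 1) → Site d × Site d, ∑' w : Fin (n + 1) → Site d,
      ∑' t : Fin (n + 1) → Site d, ∑' z : Fin (n + 1) → Site d, J b * μ (E b w t z))
    (h2 : ∀ (a : Fin (n + 1) → ι) (c : ι) (b : Fin (n + 1) → Site d × Site d) (w t z : Fin (n + 1) → Site d),
      J b * μ (E b w t z ∩ C b w t z a c) ≤
        ∑ κ : Fin (n + 1) → K, dirInd e κ b * (S (a 0) (b 0).1 (w 0) * chainTail Bpt A PE x n κ a c b w t z)) :
    Ξ ≤ ∑' u, ∑' w, ∑' t, ∑' z, ∑ κ : K, ∑ a : ι, ∑ c : ι,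
      recP S B n a u w * A κ a c u w t z * PE c (t - x) (z - x) := by
  classical
  refine le_recP_chain_of_pointwise e B Bpt hBpt A PE x n S Ξ (fun b w t z => J b * μ (E b w t z)) h1 ?_
  intro b w t z
  calc J b * μ (E b w t z)
      ≤ J b * ∑ a, ∑ c, μ (E b w t z ∩ C b w t z a c) :=
        mul_le_mul' le_rfl (measure_le_sum_sum_inter_of_subset _ _ _ (hC b w t z))
    _ = ∑ a, ∑ c, J b * μ (E b w t z ∩ C b w t z a c) := by
        rw [Finset.mul_sum]; exact Finset.sum_congr rfl fun a _ => Finset.mul_sum _ _ _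
    _ ≤ ∑ a, ∑ c, ∑ κ : Fin (n + 1) → K, dirInd e κ b *
          (S (a 0) (b 0).1 (w 0) * chainTail Bpt A PE x n κ a c b w t z) :=
        Finset.sum_le_sum fun a _ => Finset.sum_le_sum fun c _ => h2 a c b w t z
    _ = _ := sum_rot₃' _

/-- **Summing finitely many pointwise chains whose START piece depends on the first direction `κ_0`** (the shape of
the `ι`-bounds: start `δ_{0,a}δ_{κ,ι}𝟙{u=0}𝟙{w=0} + P^{ι,a}(u,w)`, `NobleWeightedBlocks.kdeltaPref` + `blockPiota`,
summed over `ι` into the `κ`-free `NobleBoundsN1IotaAvg.piotaFull`): if `Ξ_j ≤ Σ_{b,w,t,z} P_j` and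
`P_j(b,w,t,z) ≤ Σ_{κ,a,c} dirInd · (T_j^{κ_0,a_0}(u_0,w_0) · chainTail)` for each `j`, and `Σ_j T_j^{κ,a} ≤ S^{a}`
pointwise for every `κ`, then `Σ_j Ξ_j ≤ Σ_{u,w,t,z} Σ_{κ,a,c} P^{(n),a}(u,w) A P^E` with `P^{(n)} = recP S B n`.
[cite: FitznerVanDerHofstad2017, Prop. 5.6 (5.37) (p. 53), §6.1 (6.x) (p. 59), §6.2.1 (6.48)–(6.51) (pp. 65–67) (arXiv:1506.07977v2)] -/
theorem sum_le_recP_chain_of_pointwise {J : Type*} [Fintype J] (e : K → Site d)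
    (B : K → ι → ι → Site d → Site d → Site d → Site d → ℝ≥0∞)
    (Bpt : K → ι → ι → Site d → Site d → Site d → Site d → Site d → Site d → ℝ≥0∞)
    (hBpt : ∀ κ a a' u w w' u', ∑' t, ∑' z, Bpt κ a a' u w t z w' u' ≤ B κ a a' u w w' u')
    (A : K → ι → ι → Site d → Site d → Site d → Site d → ℝ≥0∞) (PE : ι → Site d → Site d → ℝ≥0∞) (x : Site d)
    (n : ℕ) (S : ι → Site d → Site d → ℝ≥0∞) (T : J → K → ι → Site d → Site d → ℝ≥0∞)
    (hT : ∀ κ a u w, ∑ j, T j κ a u w ≤ S a u w) (Ξ : J → ℝ≥0∞)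
    (P : J → (Fin (n + 1) → Site d × Site d) → (Fin (n + 1) → Site d) → (Fin (n + 1) → Site d) →
      (Fin (n + 1) → Site d) → ℝ≥0∞)
    (h1 : ∀ j, Ξ j ≤ ∑' b, ∑' w, ∑' t, ∑' z, P j b w t z)
    (h2 : ∀ j b w t z, P j b w t z ≤ ∑ κ : Fin (n + 1) → K, ∑ a : Fin (n + 1) → ι, ∑ c : ι,
      dirInd e κ b * (T j (κ 0) (a 0) (b 0).1 (w 0) * chainTail Bpt A PE x n κ a c b w t z)) :
    ∑ j, Ξ j ≤ ∑' u, ∑' w, ∑' t, ∑' z, ∑ κ : K, ∑ a : ι, ∑ c : ι,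
      recP S B n a u w * A κ a c u w t z * PE c (t - x) (z - x) := by
  classical
  refine le_recP_chain_of_pointwise e B Bpt hBpt A PE x n S _ (fun b w t z => ∑ j, P j b w t z) ?_ ?_
  · calc ∑ j, Ξ j ≤ ∑ j, ∑' b, ∑' w, ∑' t, ∑' z, P j b w t z := Finset.sum_le_sum fun j _ => h1 j
      _ = ∑' b, ∑' w, ∑' t, ∑' z, ∑ j, P j b w t z := by
          rw [← tsum_finsetSum]
          refine tsum_congr fun b => ?_
          rw [← tsum_finsetSum]
          refine tsum_congr fun w => ?_
          rw [← tsum_finsetSum]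
          refine tsum_congr fun t => ?_
          rw [← tsum_finsetSum]
  · intro b w t z
    calc ∑ j, P j b w t z
        ≤ ∑ j, ∑ κ : Fin (n + 1) → K, ∑ a : Fin (n + 1) → ι, ∑ c : ι,
            dirInd e κ b * (T j (κ 0) (a 0) (b 0).1 (w 0) * chainTail Bpt A PE x n κ a c b w t z) :=
          Finset.sum_le_sum fun j _ => h2 j b w t z
      _ = ∑ κ : Fin (n + 1) → K, ∑ a : Fin (n + 1) → ι, ∑ c : ι,
            dirInd e κ b * ((∑ j, T j (κ 0) (a 0) (b 0).1 (w 0)) * chainTail Bpt A PE x n κ a c b w t z) := by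
          rw [Finset.sum_comm]
          refine Finset.sum_congr rfl fun κ _ => ?_
          rw [Finset.sum_comm]
          refine Finset.sum_congr rfl fun a _ => ?_
          rw [Finset.sum_comm]
          refine Finset.sum_congr rfl fun c _ => ?_
          rw [Finset.sum_mul, Finset.mul_sum]
      _ ≤ ∑ κ : Fin (n + 1) → K, ∑ a : Fin (n + 1) → ι, ∑ c : ι,
            dirInd e κ b * (S (a 0) (b 0).1 (w 0) * chainTail Bpt A PE x n κ a c b w t z) := by
          gcongr with κ _ a _ c _
          exact hT _ _ _ _

end Abstract

/-! ## §2. The assembly with an arbitrary finite class index and cover -/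

/-- **[FvdH17] Lemma 6.1 / (6.4) for general `N = n + 1`: assembly from class estimates over an ARBITRARY finite
class index `ι` and an arbitrary finite cover.**  Let `E(b,w,t,z)` be events on `n + 2` levels with
`Ξ^{(n+1)}_p(x) ≤ Σ_{b,w,t,z} (∏_i J(v_i − u_i)) ℙ_p^{⊗(n+2)}(E(b,w,t,z))` (`h1`; the weight `∏ i, ENNReal.ofReal (bondJ d p ((b i).2 - (b i).1))` is
`NobleNestedXi.bondJProd d p b` by `rfl` — written out because that module's build was pending at filing time), let `C(b,w,t,z;a,c)` (`a : Fin (n+1) → ι`, `c : ι`) be finitely many events covering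
`E(b,w,t,z)` (`hC`), and suppose the CLASS ESTIMATES `h2`: `(∏J) ℙ^{⊗(n+2)}(E ∩ C(a,c)) ≤ Σ_κ 𝟙{v = u + e_κ}
S^{a_0}(u_0,w_0) ∏_{i<n} B_pt^{κ_i,a_i,a_{i+1}}(u_i,w_i,t_i,z_i,w_{i+1},u_{i+1}) A^{κ_n,a_n,c}(u_n,w_n,t_n,z_n)
P^{E,c}(t_n − x, z_n − x)` with `Σ_{t,z} B_pt ≤ B` (`hBpt`).  Then
`Ξ^{(n+1)}_p(x) ≤ Σ_{u,w,t,z} Σ_κ Σ_{a,c} P^{(n),a}(u,w) A^{κ,a,c}(u,w,t,z) P^{E,c}(t − x, z − x)`, the hypothesis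
`hΞ` (at `x`) of `BlockSummation.tsum_le_vecMul_pow_dotProduct'` — for ANY finite `ι`, so that the printed classes
`0̲, 1̲, 2̲` may be refined (junction types, variants of the middle event (4.57)–(4.59), …) by enlarging `ι`.
[cite: FitznerVanDerHofstad2017, §6.1 (6.4) (p. 58), §6.2.1 (6.48)–(6.50) (p. 65), Lemma 6.1 (6.51) (p. 66), §6.2.1 p. 67 (arXiv:1506.07977v2)] -/
theorem nobleXiT_le_recP_chain_of_cover {ι : Type*} [Fintype ι] (p : unitInterval) (x : Site d) (n : ℕ)
    (S : ι → Site d → Site d → ℝ≥0∞)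
    (B : (Fin d × Bool) → ι → ι → Site d → Site d → Site d → Site d → ℝ≥0∞)
    (Bpt : (Fin d × Bool) → ι → ι → Site d → Site d → Site d → Site d → Site d → Site d → ℝ≥0∞)
    (hBpt : ∀ κ a a' u w w' u', ∑' t, ∑' z, Bpt κ a a' u w t z w' u' ≤ B κ a a' u w w' u')
    (A : (Fin d × Bool) → ι → ι → Site d → Site d → Site d → Site d → ℝ≥0∞)
    (PE : ι → Site d → Site d → ℝ≥0∞)
    (E : (Fin (n + 1) → Site d × Site d) → (Fin (n + 1) → Site d) → (Fin (n + 1) → Site d) →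
      (Fin (n + 1) → Site d) → Set (Fin (n + 2) → BondConfig (Site d)))
    (C : (Fin (n + 1) → Site d × Site d) → (Fin (n + 1) → Site d) → (Fin (n + 1) → Site d) →
      (Fin (n + 1) → Site d) → (Fin (n + 1) → ι) → ι → Set (Fin (n + 2) → BondConfig (Site d)))
    (hC : ∀ b w t z, E b w t z ⊆ ⋃ a, ⋃ c, C b w t z a c)
    (h1 : nobleXiT d p (n + 1) x ≤ ∑' b : Fin (n + 1) → Site d × Site d, ∑' w : Fin (n + 1) → Site d,
      ∑' t : Fin (n + 1) → Site d, ∑' z : Fin (n + 1) → Site d,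
      (∏ i, ENNReal.ofReal (bondJ d p ((b i).2 - (b i).1))) * piPerc d p (n + 2) (E b w t z))
    (h2 : ∀ (a : Fin (n + 1) → ι) (c : ι) (b : Fin (n + 1) → Site d × Site d) (w t z : Fin (n + 1) → Site d),
      (∏ i, ENNReal.ofReal (bondJ d p ((b i).2 - (b i).1))) * piPerc d p (n + 2) (E b w t z ∩ C b w t z a c) ≤
        ∑ κ : Fin (n + 1) → Fin d × Bool, dirInd stepVec κ b *
          (S (a 0) (b 0).1 (w 0) * chainTail Bpt A PE x n κ a c b w t z)) :
    nobleXiT d p (n + 1) x ≤ ∑' u, ∑' w, ∑' t, ∑' z, ∑ κ : Fin d × Bool, ∑ a : ι, ∑ c : ι,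
      recP S B n a u w * A κ a c u w t z * PE c (t - x) (z - x) :=
  le_recP_chain_of_cover (piPerc d p (n + 2)) stepVec B Bpt hBpt A PE x n S _
    (fun b => ∏ i, ENNReal.ofReal (bondJ d p ((b i).2 - (b i).1))) E C hC h1 h2

/-- The same assembly with `h1` in the shape produced by a cover-based union bound on the exact nested form
`NobleNestedXi.nobleXiT_succ_succ_eq_tsum`: `Ξ^{(n+1)}(x) ≤ Σ_b (∏J) Σ_{w,t,z} ℙ^{⊗(n+2)}(E(b,w,t,z))`.
[cite: FitznerVanDerHofstad2017, §6.1 (6.4) (p. 58), §6.2.1 (6.48)–(6.51) (pp. 65–67) (arXiv:1506.07977v2)] -/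
theorem nobleXiT_le_recP_chain_of_cover' {ι : Type*} [Fintype ι] (p : unitInterval) (x : Site d) (n : ℕ)
    (S : ι → Site d → Site d → ℝ≥0∞)
    (B : (Fin d × Bool) → ι → ι → Site d → Site d → Site d → Site d → ℝ≥0∞)
    (Bpt : (Fin d × Bool) → ι → ι → Site d → Site d → Site d → Site d → Site d → Site d → ℝ≥0∞)
    (hBpt : ∀ κ a a' u w w' u', ∑' t, ∑' z, Bpt κ a a' u w t z w' u' ≤ B κ a a' u w w' u')
    (A : (Fin d × Bool) → ι → ι → Site d → Site d → Site d → Site d → ℝ≥0∞)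
    (PE : ι → Site d → Site d → ℝ≥0∞)
    (E : (Fin (n + 1) → Site d × Site d) → (Fin (n + 1) → Site d) → (Fin (n + 1) → Site d) →
      (Fin (n + 1) → Site d) → Set (Fin (n + 2) → BondConfig (Site d)))
    (C : (Fin (n + 1) → Site d × Site d) → (Fin (n + 1) → Site d) → (Fin (n + 1) → Site d) →
      (Fin (n + 1) → Site d) → (Fin (n + 1) → ι) → ι → Set (Fin (n + 2) → BondConfig (Site d)))
    (hC : ∀ b w t z, E b w t z ⊆ ⋃ a, ⋃ c, C b w t z a c)
    (h1 : nobleXiT d p (n + 1) x ≤ ∑' b : Fin (n + 1) → Site d × Site d, (∏ i, ENNReal.ofReal (bondJ d p ((b i).2 - (b i).1))) *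
      ∑' w : Fin (n + 1) → Site d, ∑' t : Fin (n + 1) → Site d, ∑' z : Fin (n + 1) → Site d,
        piPerc d p (n + 2) (E b w t z))
    (h2 : ∀ (a : Fin (n + 1) → ι) (c : ι) (b : Fin (n + 1) → Site d × Site d) (w t z : Fin (n + 1) → Site d),
      (∏ i, ENNReal.ofReal (bondJ d p ((b i).2 - (b i).1))) * piPerc d p (n + 2) (E b w t z ∩ C b w t z a c) ≤
        ∑ κ : Fin (n + 1) → Fin d × Bool, dirInd stepVec κ b *
          (S (a 0) (b 0).1 (w 0) * chainTail Bpt A PE x n κ a c b w t z)) :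
    nobleXiT d p (n + 1) x ≤ ∑' u, ∑' w, ∑' t, ∑' z, ∑ κ : Fin d × Bool, ∑ a : ι, ∑ c : ι,
      recP S B n a u w * A κ a c u w t z * PE c (t - x) (z - x) :=
  nobleXiT_le_recP_chain_of_cover p x n S B Bpt hBpt A PE E C hC
    (h1.trans_eq (tsum_mul_tsum₃_eq _ _)) h2

end Literature.Probability.FitznerVanDerHofstad2017

end
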